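import Summits.HubbardSuperconductivity.HubbardSuperconductivity.Theses.KLProgramme
import Summits.HubbardSuperconductivity.HubbardSuperconductivity.Theorems.KLProgrammeKLRegimeEngineV14.Negative.InvisibleFrame

/-!
# `KLRegimeEngineV14` (deciding crux stmt-HubbardSuperconductivity-19918, route `KLProgramme`) is FALSE AS TYPED modulo the
# scale-`0` radial regularity `H` of the bare model's local self-energy — a NEGATIVE LEMMA MODULO `H` (refuter lane, D-0016)

`KLRegimeEngineV14 := EngineP4 klPredsV14 klWindowC`.  Its two-leg slot `TwoLegStepV14 … K n` contains (via `TwoLegCoreT`) the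
frame-Lipschitz clause (E3c-T) `FrameLipschitzFnT L M hist G Q R β U μ K n`:
`∀ K' admissible, hist K' below n ⇒ ∀ q, |ℓ_n(K.eval)(q) − ℓ_n(K'.eval)(q)| ≤ lipBar G Q U n · frameDist K K'`,
whose pieces `ℓ_n = klTwoLegPieceFn` are built on the FUNCTION carrier: the local part `ν_n(K)` reads the LATTICE self-energy of
the model with frame `toTrigPoly L K` (the interpolant of the frame's values at the `L × L` lattice momenta) while the normal form
`P(K)` reads the CONTINUUM frame `K` on its own Fermi curve.  A frame perturbation that vanishes at every lattice momentum —
`K' = ε (h_{L,0} − h_{0,0})`, `K'(p) = ε((cos(L p₀) + cos(L p₁))/2 − 1)` — is therefore invisible to the model (`toTrigPoly L K'.eval =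
toTrigPoly L 0`) but moves `P`: at scale `n = 0` (empty history), frame `K = 0` versus `K'`, at the tube point `q⋆ = (2π/3, 0)`
(free Fermi point of `μ = -1` on the ray `θ = 0`, flat cutoff `= 1`),
`ℓ_0(0)(q⋆) − ℓ_0(K')(q⋆) = [F(u_0·dir 0) − F(u_{K'}·dir 0)] + K'(u_{K'}·dir 0)`,
`F := symInterp L (klLocSelfEnergyRe L M β U (-1) (toTrigPoly L 0) 0)` the interpolated scale-`0` local self-energy of the bare
model, `u_0 = 2π/3`, `|u_{K'} − u_0| ≤ 2ε/Dt_min` (BGM (2.40) order zero).  With `L ≡ 1 (mod 3)` the frame term is `≤ −7ε/12`,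
while `lipBar · frameDist 0 K' ≤ 2(G.SL + Q.SL·U)U·ε`; `K'` is admissible (`FrameOK`) as soon as `2(1+L)⁴ε ≤ U²` — at EVERY
volume above the engine's own thresholds, so no threshold `L₃, M₃` can exclude it (the class `FrameOK` carries no degree bound).

The one ingredient the tree cannot supply is the size of the model term `F(u_0·dir 0) − F(u_{K'}·dir 0)`: ANY `O(U)` radial
Lipschitz bound of `F` on the ray near `u_0` finishes the contradiction.  That bound is scale-`0` engine content (BGM 2006 §2.4, Lemma 2.1
and (2.36)–(2.41): the scale-by-scale dispersion corrections `E_h − ε₀` and their momentum derivatives are `O(U)`, for the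
infinite-volume object) and is NOT constructible here (no theorem of the tree bounds `klSelfEnergy` at all): it is this file's hypothesis
`ScaleZeroSelfEnergyRadialLipschitz` (`H`), and the theorem is `H → ¬ KLRegimeEngineV14`.

Findings for the planner / provers (p1b g7's Δ25 F2, independently re-derived and kernel-checked modulo `H`):
* the blind spot is STRUCTURAL (continuum frame class vs lattice-valued model), not a constant: it bites at every volume, for
  every choice of the engine's records `G, Q, c₃, U₀, L₃, M₃`;
* repair = make the frame class lattice-resolvable at the volumes used: a degree clause `K.degree ≤ d(β)` in `FrameOK` together with
  `L₃ β U > 2 d(β)` (Nyquist), or read `P(K)` through `toTrigPoly L K` as well (then `K ↦ toTrigPoly L K.eval` is the identity on the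
  class and the witness dies);
* this file does NOT refute the crux: it is a negative lemma modulo `H`; composing it with a construction of `H` would.
-/

noncomputable section

set_option linter.dupNamespace false

namespace Summit.HubbardSuperconductivity.HubbardSuperconductivity.Theorems.KLRegimeEngineV14.Negative

open Real Finset Literature.MathematicalPhysics.QuantumLattice Literature.Probability.LatticeModels
open Literature.MathematicalPhysics.QuantumLattice.FermiRG
open Literature.MathematicalPhysics.QuantumLattice.BandSectorCounting
open Summit.HubbardSuperconductivity.HubbardSuperconductivity.Theorems.KLRegimeSplit
open Summit.HubbardSuperconductivity.HubbardSuperconductivity.Theorems.DispersionFlow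
open Summit.HubbardSuperconductivity.HubbardSuperconductivity.Theorems.PerturbedFermiCurve
open Summit.HubbardSuperconductivity.HubbardSuperconductivity.Theorems.KLProgrammeLegKernels

/-! ## §1 The hypothesis `H` -/

/-- **`H` — scale-`0` radial Lipschitz regularity of the bare model's local self-energy, linear in `U`.**  There are `C ≥ 0` and
`U₁ > 0` such that for every `0 < U ≤ U₁` there are volume thresholds `L₁`, `M₁ L` beyond which, at `β = klBetaMin`, `μ = -1`,
frame `toTrigPoly L 0` (the bare frame as the model sees it) and scale `0`, the interpolated local self-energy
`F = symInterp L (klLocSelfEnergyRe L M klBetaMin U (-1) (toTrigPoly L 0) 0)` satisfies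
`|F(r·dir 0) − F(r'·dir 0)| ≤ C·U·|r − r'|` for all `r, r'` within `1/10` of the free Fermi radius `2π/3` of the ray `θ = 0`.
(Scale-`0` engine content — BGM 2006 §2.4 Lemma 2.1, (2.36)–(2.41): the dispersion corrections and their momentum derivatives
are `O(U)` (reference: Benfatto–Giuliani–Mastropietro, Ann. Henri Poincaré 7 (2006), bib key `BenfattoGiulianiMastropietro2006`);
not constructible in the tree today, which has no bound on `klSelfEnergy`.  Stated here, next to its only use, because it is
phrased through the route's own objects `symInterp`, `klLocSelfEnergyRe`, `toTrigPoly`, `dir`, which no `Literature/` module sees.) -/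
def ScaleZeroSelfEnergyRadialLipschitz : Prop :=
  ∃ C : ℝ, 0 ≤ C ∧ ∃ U₁ : ℝ, 0 < U₁ ∧ ∀ U : ℝ, 0 < U → U ≤ U₁ →
    ∃ L₁ : ℕ, ∃ M₁ : ℕ → ℕ, ∀ (L M : ℕ) [NeZero L] [NeZero M], L₁ ≤ L → M₁ L ≤ M →
      ∀ r r' : ℝ, |r - 2 * π / 3| ≤ 1 / 10 → |r' - 2 * π / 3| ≤ 1 / 10 →
        |(symInterp L (klLocSelfEnergyRe L M klBetaMin U (-1) (toTrigPoly L 0) 0)).eval (r • dir 0) -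
            (symInterp L (klLocSelfEnergyRe L M klBetaMin U (-1) (toTrigPoly L 0) 0)).eval (r' • dir 0)| ≤
          C * U * |r - r'|

/-! ## §2 Arithmetic of the constants -/

/-- `β_min = 128 ≤ exp(c₃/U²)` once `U ≤ min 1 (c₃/127)`. -/
private theorem betaMin_le_exp {U c : ℝ} (hU : 0 < U) (hU1 : U ≤ 1) (hUc : U ≤ c / 127) :
    klBetaMin ≤ Real.exp (c / U ^ 2) := by
  have h127 : 127 * U ≤ c := by rw [le_div_iff₀ (by norm_num : (0:ℝ) < 127)] at hUc; linarith
  have hU2 : U ^ 2 ≤ U := by nlinarith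
  have h1 : (127 : ℝ) ≤ c / U ^ 2 := by rw [le_div_iff₀ (by positivity)]; nlinarith
  have h2 := Real.add_one_le_exp (c / U ^ 2)
  show (128 : ℝ) ≤ _
  linarith

/-- The `H` term is `≤ ε/12` once `U ≤ Dt/(24(C+1))`. -/
private theorem hTerm_small {C U D ε : ℝ} (hC : 0 ≤ C) (hD : 0 < D) (hε : 0 ≤ ε)
    (hUD : U ≤ D / (24 * (C + 1))) : C * U * (2 * ε / D) ≤ ε / 12 := by
  have hCU : C * U ≤ D / 24 := by
    have h1 : C * U ≤ C * (D / (24 * (C + 1))) := mul_le_mul_of_nonneg_left hUD hC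
    have h2 : C * (D / (24 * (C + 1))) ≤ D / 24 := by
      rw [mul_div_assoc', div_le_div_iff₀ (by positivity) (by norm_num)]
      nlinarith
    exact h1.trans h2
  have : C * U * (2 * ε / D) = (C * U) * (2 * ε) / D := by ring
  rw [this, div_le_iff₀ hD]
  nlinarith

/-- `L · (2ε/Dt) ≤ 1/3` once `ε ≤ Dt/(6L)`. -/
private theorem side_mul_shift_le {L D ε : ℝ} (hL : 0 < L) (hD : 0 < D) (hεD : ε ≤ D / (6 * L)) :
    L * (2 * ε / D) ≤ 1 / 3 := by
  rw [le_div_iff₀ (by positivity)] at hεD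
  rw [mul_div_assoc', div_le_iff₀ hD]
  linarith

/-- `2ε/Dt ≤ 1/10` once `ε ≤ Dt/(6L)` and `L ≥ 13`. -/
private theorem shift_le_tenth {L D ε : ℝ} (hL : 13 ≤ L) (hD : 0 < D) (hε : 0 ≤ ε) (hεD : ε ≤ D / (6 * L)) :
    2 * ε / D ≤ 1 / 10 := by
  have hL0 : 0 < L := by linarith
  have h := side_mul_shift_le hL0 hD hεD
  have h0 : 0 ≤ 2 * ε / D := by positivity
  nlinarith

/-- The Lipschitz constant at scale `0` is `≤ 1/8` once `U ≤ min 1 (1/(8(|G.SL|+|Q.SL|+1)))`. -/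
private theorem lipBar_zero_le (G : GeoConsts) (Q : EngConsts) {U : ℝ} (hU : 0 < U) (hU1 : U ≤ 1)
    (hUs : U ≤ 1 / (8 * (|G.SL| + |Q.SL| + 1))) : lipBar G Q U 0 ≤ 1 / 8 := by
  unfold lipBar
  rw [pow_zero, inv_one, mul_one, abs_of_pos hU]
  have hs : 0 < |G.SL| + |Q.SL| + 1 := by positivity
  have h1 : G.SL + Q.SL * U ≤ |G.SL| + |Q.SL| + 1 := by
    have hQ : Q.SL * U ≤ |Q.SL| := by
      have := mul_le_mul_of_nonneg_left hU1 (abs_nonneg Q.SL)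
      nlinarith [le_abs_self Q.SL, abs_nonneg Q.SL]
    linarith [le_abs_self G.SL]
  have h2 : (G.SL + Q.SL * U) * U ≤ (|G.SL| + |Q.SL| + 1) * U := mul_le_mul_of_nonneg_right h1 hU.le
  have h3 : (|G.SL| + |Q.SL| + 1) * U ≤ 1 / 8 := by
    have := hUs
    rw [le_div_iff₀ (by positivity)] at this
    nlinarith
  exact h2.trans h3

/-- Allowance: `lipBar · frameDist ≤ ε/4` from `lipBar ≤ 1/8` and `0 ≤ frameDist ≤ 2ε`. -/
private theorem allowance_le {a d ε : ℝ} (ha : a ≤ 1 / 8) (hd0 : 0 ≤ d) (hd : d ≤ 2 * ε) : a * d ≤ ε / 4 := by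
  nlinarith

/-- The frame term: `ε(cos x − 1)/2 ≤ −(7/12)ε` once `cos x ≤ −1/6`. -/
private theorem frameTerm_le {ε x : ℝ} (hε : 0 ≤ ε) (hcos : Real.cos x ≤ -1 / 6) :
    ε * (Real.cos x - 1) / 2 ≤ -(7 / 12) * ε := by
  nlinarith

/-- `cos(L r) ≤ −1/6` when `cos(L·2π/3) = −1/2` and `L|r − 2π/3| ≤ 1/3`. -/
private theorem cos_side_mul_le {L r : ℝ} (hL : 0 < L) (hcosL : Real.cos (L * (2 * π / 3)) = -1 / 2)
    (h : L * |r - 2 * π / 3| ≤ 1 / 3) : Real.cos (L * r) ≤ -1 / 6 := by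
  have hc := Real.abs_cos_sub_cos_le (L * r) (L * (2 * π / 3))
  rw [← mul_sub, abs_mul, abs_of_pos hL, hcosL] at hc
  have := (abs_le.mp (hc.trans h)).2
  linarith

/-! ## §3 The negative lemma -/

/-- **`KLRegimeEngineV14` is false modulo `H`.**  Given the scale-`0` radial Lipschitz bound `H` of the bare model's interpolated
local self-energy, the frame-Lipschitz clause (E3c-T) of `EngineP4 klPredsV14 klWindowC` fails at scale `0`, `μ = -1`,
`β = klBetaMin`, frame `0` against the lattice-invisible admissible frame `ε(h_{L,0} − h_{0,0})`, at the tube point `(2π/3, 0)`,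
for a suitable small `U`, a side `L ≡ 1 (mod 3)` above every threshold and `ε = min(U²/2(1+L)⁴, Dt_min/6L)`.  Axioms: standard. -/
theorem KLRegimeEngineV14_false_of_ScaleZeroSelfEnergyRadialLipschitz :
    ScaleZeroSelfEnergyRadialLipschitz →
      ¬ Summit.HubbardSuperconductivity.HubbardSuperconductivity.Theses.KLProgramme.KLRegimeEngineV14 := by
  rintro ⟨C, hC, U₁, hU₁, hH⟩ hE
  obtain ⟨G, -, hE⟩ := hE
  -- refuter's choices for `∀ P` and `∀ R`: `P₀ = (1, 0, 0, 0)`, `R₀` with unit frame-smoothness allowances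
  obtain ⟨P₀, hP₀⟩ : ∃ P : SplitConsts, P = ⟨1, 0, 0, 0⟩ := ⟨_, rfl⟩
  obtain ⟨R₀, hR₀⟩ : ∃ R : RenConsts, R = ⟨1, 1, fun _ => 1⟩ := ⟨_, rfl⟩
  obtain ⟨Q, -, c₃, hc₃, hE⟩ := hE P₀ (by rw [hP₀]; refine ⟨?_, ?_, ?_⟩ <;> simp) R₀
    (by rw [hR₀]; refine ⟨⟨?_, ?_, fun j => ?_⟩, ?_, ?_⟩ <;> simp)
  have hRG : ∀ j, R₀.Gfr j = 1 := fun j => by rw [hR₀]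
  clear hP₀ hR₀
  obtain ⟨U₀, hU₀, L₃, M₃, hE⟩ := hE c₃ hc₃ le_rfl
  -- the band-geometry constant `Dt_min` of the level window `[-1.1, -0.9]`
  obtain ⟨B, -⟩ : ∃ B : BandBounds (-1.1) (-0.9), True :=
    ⟨bandBounds (by norm_num) (by norm_num) (by norm_num), trivial⟩
  have hD : 0 < B.Dtmin := B.Dtmin_pos
  -- the coupling
  have hs0 : 0 < |G.SL| + |Q.SL| + 1 := by positivity
  obtain ⟨U, hU_def⟩ : ∃ U : ℝ, U = min (min (min U₀ U₁) (min (1 / 50) (c₃ / 127)))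
      (min (B.Dtmin / (24 * (C + 1))) (1 / (8 * (|G.SL| + |Q.SL| + 1)))) := ⟨_, rfl⟩
  have hU0 : 0 < U := by rw [hU_def]; positivity
  have hUa : U ≤ min (min U₀ U₁) (min (1 / 50) (c₃ / 127)) := hU_def ▸ min_le_left _ _
  have hUb : U ≤ min (B.Dtmin / (24 * (C + 1))) (1 / (8 * (|G.SL| + |Q.SL| + 1))) := hU_def ▸ min_le_right _ _
  have hUU₀ : U ≤ U₀ := hUa.trans ((min_le_left _ _).trans (min_le_left _ _))
  have hUU₁ : U ≤ U₁ := hUa.trans ((min_le_left _ _).trans (min_le_right _ _))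
  have hU50 : U ≤ 1 / 50 := hUa.trans ((min_le_right _ _).trans (min_le_left _ _))
  have hUc : U ≤ c₃ / 127 := hUa.trans ((min_le_right _ _).trans (min_le_right _ _))
  have hUD : U ≤ B.Dtmin / (24 * (C + 1)) := hUb.trans (min_le_left _ _)
  have hUs : U ≤ 1 / (8 * (|G.SL| + |Q.SL| + 1)) := hUb.trans (min_le_right _ _)
  have hU1 : U ≤ 1 := hU50.trans (by norm_num)
  clear hUa hUb hU_def
  -- `H` at this coupling
  obtain ⟨L₁, M₁, hH⟩ := hH U hU0 hUU₁
  -- the side `L = 3k + 1` above both thresholds, and the Matsubara cutoff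
  obtain ⟨k, hk⟩ : ∃ k : ℕ, k = L₃ klBetaMin U + L₁ + 4 := ⟨_, rfl⟩
  obtain ⟨L, hL⟩ : ∃ L : ℕ, L = 3 * k + 1 := ⟨_, rfl⟩
  have hL0 : L ≠ 0 := by omega
  haveI : NeZero L := ⟨hL0⟩
  obtain ⟨M, hM⟩ : ∃ M : ℕ, M = M₃ klBetaMin U L + M₁ L + 1 := ⟨_, rfl⟩
  haveI : NeZero M := ⟨by omega⟩
  have hLpos : (0 : ℝ) < L := by exact_mod_cast Nat.pos_of_ne_zero hL0
  have hL13 : (13 : ℝ) ≤ L := by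
    have : 13 ≤ L := by omega
    exact_mod_cast this
  have hL1 : (1 : ℝ) ≤ 1 + L := by linarith
  -- the engine's two-leg step at scale `0`, frame `0`, `μ = -1`, `β = klBetaMin`
  have hμ : (-1 : ℝ) ∈ klWindowC := by
    simp only [klWindowC, Set.mem_Icc]; norm_num
  have hμ' : (-1 : ℝ) ∈ Set.Icc (-1.05 : ℝ) (-0.15) := by
    simp only [Set.mem_Icc]; norm_num
  have hKL : IsKLRegime U c₃ (-((0 : ℕ) : ℤ)) := by
    unfold IsKLRegime; simp; exact hc₃.le
  have hHist : HistP klPredsV14 L M G P₀ Q R₀ klBetaMin U (-1) 0 0 := fun j hj => absurd hj (Nat.not_lt_zero j)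
  have hstep := hE (-1) hμ U hU0 hUU₀ klBetaMin le_rfl (betaMin_le_exp hU0 hU1 hUc) 0
    (frameOK_zero_covWindow (R := R₀) (fun j => (hRG j).symm ▸ zero_le_one) hμ' U _) L M (by omega) (by omega) 0
    (Nat.zero_le _)
    hKL hHist
  clear hE
  have hLip : FrameLipschitzFnT L M (histV14 L M G P₀ Q R₀ klBetaMin U (-1)) G Q R₀ klBetaMin U (-1) 0 0 :=
    hstep.2.1.2.1
  clear hstep hHist hKL
  -- the perturbation size
  obtain ⟨ε, hε⟩ : ∃ ε : ℝ, ε = min (U ^ 2 / (2 * (1 + (L : ℝ)) ^ 4)) (B.Dtmin / (6 * L)) := ⟨_, rfl⟩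
  have hε0 : 0 < ε := by rw [hε]; positivity
  have hε4 : 2 * (1 + (L : ℝ)) ^ 4 * ε ≤ U ^ 2 := by
    have h : ε ≤ U ^ 2 / (2 * (1 + (L : ℝ)) ^ 4) := hε ▸ min_le_left _ _
    rw [le_div_iff₀ (by positivity)] at h
    linarith
  have hεD : ε ≤ B.Dtmin / (6 * L) := hε ▸ min_le_right _ _
  clear hε
  have hε2 : 2 * (1 + (L : ℝ)) ^ 2 * ε ≤ 1 / 2000 := by
    have h1 : 2 * (1 + (L : ℝ)) ^ 2 * ε ≤ 2 * (1 + (L : ℝ)) ^ 4 * ε := by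
      have := pow_le_pow_right₀ hL1 (by norm_num : 2 ≤ 4)
      nlinarith
    have h2 : U ^ 2 ≤ 1 / 2000 := by nlinarith
    linarith
  have hεsmall : 2 * ε ≤ 1 / 20 := by
    have h1 : 2 * ε ≤ 2 * (1 + (L : ℝ)) ^ 2 * ε := by
      have := one_le_pow₀ (n := 2) hL1
      nlinarith
    linarith
  -- the lattice-invisible frame `K' = ε (h_{L,0} − h_{0,0})` and the Lipschitz clause against it, at `q⋆`
  obtain ⟨K', hK'⟩ : ∃ K' : TrigPolyC4v,
      K' = ⟨L, fun m n => if m = L ∧ n = 0 then ε else if m = 0 ∧ n = 0 then -ε else 0⟩ := ⟨_, rfl⟩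
  have hq := hLip K' (frameOK_invisibleFrame hL0 hε0 hU0 hU1 hε4 hε2 (fun j => (hRG j).symm ▸ le_rfl) hμ' _ hK')
    (fun j hj => absurd hj (Nat.not_lt_zero j)) ![2 * π / 3, 0]
  clear hLip
  -- evaluate both pieces at `q⋆`
  have h0eval : (0 : TrigPolyC4v).eval = (0 : FrameFn) := funext TrigPolyC4v.eval_zero
  rw [h0eval, klTwoLegPieceFn_zero_qstar, klTwoLegPieceFn_zero_qstar, klFermiPointFn_zero_frame,
    toTrigPoly_invisibleFrame hK'] at hq
  obtain ⟨F, hF⟩ : ∃ F : TrigPolyC4v, F = symInterp L (klLocSelfEnergyRe L M klBetaMin U (-1) (toTrigPoly L 0) 0) :=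
    ⟨_, rfl⟩
  obtain ⟨r₁, hr₁⟩ : ∃ r : ℝ, r = perturbedFermiRadius (fun p => -K'.eval p) (-1) 0 := ⟨_, rfl⟩
  have hkF' : klFermiPointFn (-1) K'.eval 0 = r₁ • dir 0 := by rw [hr₁]; rfl
  rw [hkF', ← hF] at hq
  simp only [Pi.zero_apply, sub_zero] at hq
  -- `|u_{K'} − 2π/3| ≤ 2ε/Dt_min` (BGM (2.40), order zero)
  have hr₁close : |r₁ - 2 * π / 3| ≤ 2 * ε / B.Dtmin := by
    rw [hr₁]; exact abs_perturbedFermiRadius_invisibleFrame_sub_le B hL0 hε0.le hεsmall hK'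
  -- the `H` term is `≤ ε/12`
  have hA : |F.eval ((2 * π / 3) • dir 0) - F.eval (r₁ • dir 0)| ≤ ε / 12 := by
    have h := hH L M (by omega) (by omega) (2 * π / 3) r₁ (by simp)
      (hr₁close.trans (shift_le_tenth hL13 hD hε0.le hεD))
    rw [← hF] at h
    refine h.trans ?_
    rw [abs_sub_comm]
    have h1 : C * U * |r₁ - 2 * π / 3| ≤ C * U * (2 * ε / B.Dtmin) :=
      mul_le_mul_of_nonneg_left hr₁close (by positivity)
    exact h1.trans (hTerm_small hC hD hε0.le hUD)
  -- the frame term is `≤ −7ε/12` (`L ≡ 1 (mod 3)` puts `cos(L·u_{K'})` near `−1/2`)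
  have hcosL : Real.cos (L * (2 * π / 3)) = -1 / 2 := by
    have : (L : ℝ) * (2 * π / 3) = 2 * π / 3 + (k : ℕ) * (2 * π) := by
      rw [hL]; push_cast; ring
    rw [this, Real.cos_add_nat_mul_two_pi, (by ring : 2 * π / 3 = π - π / 3), Real.cos_pi_sub, Real.cos_pi_div_three]
    norm_num
  have hKt : K'.eval (r₁ • dir 0) ≤ -(7 / 12) * ε := by
    rw [invisibleFrame_eval_ray hL0 hK']
    exact frameTerm_le hε0.le (cos_side_mul_le hLpos hcosL
      ((mul_le_mul_of_nonneg_left hr₁close hLpos.le).trans (side_mul_shift_le hLpos hD hεD)))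
  -- the allowance is `≤ ε/4`
  have hR : lipBar G Q U 0 * frameDist 0 K' ≤ ε / 4 :=
    allowance_le (lipBar_zero_le G Q hU0 hU1 hUs) (Real.iSup_nonneg fun p => abs_nonneg _)
      (frameDist_zero_invisibleFrame_le hL0 hε0.le hK')
  -- contradiction: the difference is `≤ −ε/2` but its absolute value is `≤ ε/4`
  have h1 := (abs_le.mp (hq.trans hR)).1
  have h2 := le_abs_self (F.eval ((2 * π / 3) • dir 0) - F.eval (r₁ • dir 0))
  linarith

end Summit.HubbardSuperconductivity.HubbardSuperconductivity.Theorems.KLRegimeEngineV14.Negative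

end
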